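import Summits.HodgeConjecture.HodgeConjecture.Theorems.WeilTypeLadderTargetTransfer
import Literature.AlgebraicGeometry.HodgeTheory.FermatHodgeConjectureProducts
import Mathlib.RingTheory.Polynomial.Cyclotomic.Roots
import Mathlib.RingTheory.Polynomial.Eisenstein.Basic
import Mathlib.Analysis.SpecialFunctions.Complex.Circle
import Mathlib.Tactic.ComputeDegree
import HarnessLib

/-!
# WeilTypeLadder · R3 (`WeilClassesCMField`) for the CYCLIC QUARTIC CM subfield `K′ = ℚ(ζ₁₆ + ζ₁₆⁷) = ℚ(ζ₁₆)^{⟨7⟩}` of `ℚ(ζ₁₆)`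
# (`K′ = ℚ(√(√2 − 2))`, NOT a cyclotomic field): minimal polynomial `T⁴ + 4T² + 2`, the rung's eight arithmetic hypotheses
# DISCHARGED (Eisenstein at `2`, purely imaginary roots, `Q = −T`, `P(s + s⁷) = 0 ⇐ Φ₁₆(s) = 0`), the transfer over `Xʰ₁₆ ⊗ Xʰ₁₆`

b2b cell `hweil` (packet `run/shared/lean/b2b/hodge-weil/`, report `b2b-hweil-pv3-g43/CM-SUBFIELD-TRANSFER.md` §3.3 row
`(16, E^{⟨7⟩})` and ADDENDUM A). Companion of `Theorems/WeilTypeLadderCyclicPrymQuarticCMField` (the rows `ℚ(ζ₅) ⊂ ℚ(ζ₁₅)`,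
`ℚ(ζ₅) ⊂ ℚ(ζ₂₀)`, `ℚ(ζ₈) ⊂ ℚ(ζ₁₆)`, where `P` is a cyclotomic polynomial). Here `K′` is the OTHER quartic CM subfield of
`E = ℚ(ζ₁₆)`: the fixed field of `ζ ↦ ζ⁷`, generated by `θ = ζ₁₆ + ζ₁₆⁷ = ζ₁₆ − ζ₁₆⁻¹ = 2i·sin(π/8)`, `θ² = √2 − 2`, with
minimal polynomial `P = T⁴ + 4T² + 2` (Eisenstein at `2`); on an abelian variety `B` with `s : B ⟶ B`, `Φ₁₆(s) = s⁸ + 1 = 0`, the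
field `K′` acts through `φ := s + s⁷`, and `P(φ) = 0` because `P(T + T⁷) = (T⁸ + 1)·(T²⁰ + 4T¹⁴ − T¹² + 6T⁸ + T⁴ + 4T² + 2)` in `ℤ[T]`.

What is PROVED here (kernel): (§1) `P` monic of degree `4`, irreducible over `ℚ` (Eisenstein at `(2) ⊂ ℤ` + Gauss); every complex
root `ρ` of `P` is non-real and `ρ̄ = −ρ` (`ρ² = −2 ± √2 ∈ ℝ`), so `Q = −T` carries roots to conjugates; `Φ₁₆ = T⁸ + 1`; the
division identity; `P(s + s⁷) = 0` in `End B`. (§2) the R3 body on this locus over a Fermat PAIR `Xʰ₁₆ ⊗ Xʰ₁₆` from the two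
refereed named facts (`hodgeClasses_algebraic_fermatProduct₂`, `fulton1998_map_mem_algebraicClasses`); from the rung — an HONEST
SPECIALISATION at `(A, φ, P, e, m) := (B, s + s⁷, T⁴ + 4T² + 2, 4, h)`, all eight hypotheses discharged —; ON-PATH from `HodgeConjecture`.

What is NOT in the kernel: the datum (PROPOSITION CYC′ of the report, pen-and-paper) and `K′`-Weil-ness (THEOREM W′). Census
(report §3.3, two implementations): at `N = 4` the unique `K′`-Weil NON-`E`-Weil family for this `K′` is `β = (1,2,4,9)`
(`y¹⁶ = (x−b₁)(x−b₂)²(x−b₃)⁴(x−b₄)⁹`; `D = (0,1,1,2,0,1,1,2)` on `k = 1,3,…,15`; MOVING) — a one-parameter family of abelian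
EIGHTFOLDS whose `K′`-Weil classes in `H⁴` are not products of Hodge classes of `H²`.

HONEST LABEL: a one-parameter sub-family of the `8`-dimensional Shimura variety of `K′`-Weil type, never the general member;
0 unconditional rungs above the floor; conditional on [Shioda 1979 Thm. 2] + [Fulton 1998 Cor. 19.2 (b)] (refereed) and on the
datum; Markman-free; the standing `weilClassesField = W_{K′} ⊗ ℂ` identification flag applies. No `sorry`, no new named fact; ONE
abbreviation-free polynomial constant is spelled out in each statement (no `def`).
-/

noncomputable section

-- every declaration of this problem lives in `Summit.HodgeConjecture.HodgeConjecture.…` (summit = sub-problem)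
set_option linter.dupNamespace false

open CategoryTheory MonoidalCategory Polynomial
open Literature.AlgebraicGeometry Literature.AlgebraicGeometry.Motives
open Literature.AlgebraicGeometry.HodgeTheory
open Literature.AlgebraicTopology.SingularHomology

namespace Summit.HodgeConjecture.HodgeConjecture.WeilTypeLadder

/-! ### §1 The quartic `T⁴ + 4T² + 2` and `Φ₁₆` -/

section Quartic

/-- `T⁴ + 4T² + 2 ∈ ℤ[T]` is monic. [folklore] -/
theorem quarticSixteen_monic : (X ^ 4 + 4 * X ^ 2 + 2 : Polynomial ℤ).Monic := by
  monicity!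

/-- `T⁴ + 4T² + 2` has degree `4`. [folklore] -/
theorem quarticSixteen_natDegree : (X ^ 4 + 4 * X ^ 2 + 2 : Polynomial ℤ).natDegree = 4 := by
  compute_degree!

/-- The coefficients of `T⁴ + 4T² + 2` below the top one are even. [folklore] -/
theorem quarticSixteen_coeff_mem {n : ℕ} (hn : n < 4) :
    (X ^ 4 + 4 * X ^ 2 + 2 : Polynomial ℤ).coeff n ∈ Ideal.span {(2 : ℤ)} := by
  rw [Ideal.mem_span_singleton]
  interval_cases n <;> simp [coeff_X_pow, coeff_ofNat_mul]

/-- `T⁴ + 4T² + 2` is Eisenstein at `(2)`. [folklore] -/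
theorem quarticSixteen_isEisensteinAt :
    (X ^ 4 + 4 * X ^ 2 + 2 : Polynomial ℤ).IsEisensteinAt (Ideal.span {(2 : ℤ)}) where
  leading := by
    rw [Polynomial.Monic.leadingCoeff quarticSixteen_monic, Ideal.mem_span_singleton]; norm_num
  mem := fun {n} hn => quarticSixteen_coeff_mem (by rwa [quarticSixteen_natDegree] at hn)
  notMem := by
    rw [Ideal.span_singleton_pow, Ideal.mem_span_singleton]
    simp [coeff_X_pow, coeff_ofNat_mul]

/-- `T⁴ + 4T² + 2` is irreducible over `ℚ` (Eisenstein at `2` over `ℤ`, then Gauss's lemma). [folklore] -/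
theorem quarticSixteen_irreducible :
    Irreducible ((X ^ 4 + 4 * X ^ 2 + 2 : Polynomial ℤ).map (Int.castRingHom ℚ)) := by
  have hprime : (Ideal.span {(2 : ℤ)}).IsPrime :=
    (Ideal.span_singleton_prime (by norm_num)).mpr Int.prime_two
  have hZ : Irreducible (X ^ 4 + 4 * X ^ 2 + 2 : Polynomial ℤ) :=
    quarticSixteen_isEisensteinAt.irreducible hprime quarticSixteen_monic.isPrimitive
      (by rw [quarticSixteen_natDegree]; norm_num)
  have := (Polynomial.IsPrimitive.irreducible_iff_irreducible_map_fraction_map (K := ℚ)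
    quarticSixteen_monic.isPrimitive).1 hZ
  rwa [← algebraMap_int_eq]

/-- Evaluation of `T⁴ + 4T² + 2` in any ring. -/
theorem eval₂_quarticSixteen {R : Type*} [Ring R] (x : R) :
    Polynomial.eval₂ (Int.castRingHom R) x (X ^ 4 + 4 * X ^ 2 + 2 : Polynomial ℤ) = x ^ 4 + 4 * x ^ 2 + 2 := by
  rw [← algebraMap_int_eq, ← Polynomial.aeval_def]
  simp only [map_add, map_mul, map_pow, Polynomial.aeval_X, map_ofNat]

/-- A complex root `ρ` of `T⁴ + 4T² + 2` has `ρ² = −2 ± √2`, a REAL number; in particular `ρ̄² = ρ²`. [folklore] -/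
theorem conj_sq_eq_sq_of_quarticSixteen {ρ : ℂ} (hρ : ρ ^ 4 + 4 * ρ ^ 2 + 2 = 0) :
    starRingEnd ℂ (ρ ^ 2) = ρ ^ 2 := by
  have h2 : (ρ ^ 2 + 2) ^ 2 = ((Real.sqrt 2 : ℝ) : ℂ) ^ 2 := by
    have hs : ((Real.sqrt 2 : ℝ) : ℂ) ^ 2 = 2 := by
      rw [← Complex.ofReal_pow, Real.sq_sqrt (by norm_num : (0 : ℝ) ≤ 2)]; norm_num
    rw [hs]; linear_combination hρ
  rcases sq_eq_sq_iff_eq_or_eq_neg.1 h2 with h | h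
  · have : ρ ^ 2 = ((Real.sqrt 2 - 2 : ℝ) : ℂ) := by push_cast; linear_combination h
    rw [this, Complex.conj_ofReal]
  · have : ρ ^ 2 = ((-Real.sqrt 2 - 2 : ℝ) : ℂ) := by push_cast; linear_combination h
    rw [this, Complex.conj_ofReal]

/-- The complex roots of `T⁴ + 4T² + 2` are NON-REAL (`r⁴ + 4r² + 2 > 0` for real `r`): the rung's "no real root". [folklore] -/
theorem conj_ne_self_of_quarticSixteen {ρ : ℂ}
    (hρ : Polynomial.eval₂ (Int.castRingHom ℂ) ρ (X ^ 4 + 4 * X ^ 2 + 2 : Polynomial ℤ) = 0) :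
    starRingEnd ℂ ρ ≠ ρ := by
  rw [eval₂_quarticSixteen] at hρ
  intro hc
  have hre : ((ρ.re : ℝ) : ℂ) = ρ := Complex.conj_eq_iff_re.mp hc
  have hr : ((ρ.re ^ 4 + 4 * ρ.re ^ 2 + 2 : ℝ) : ℂ) = 0 := by push_cast; rw [hre]; exact hρ
  have hr' : ρ.re ^ 4 + 4 * ρ.re ^ 2 + 2 = 0 := by exact_mod_cast hr
  nlinarith [sq_nonneg ρ.re, sq_nonneg (ρ.re ^ 2)]

/-- `Q = −T` carries every complex root of `T⁴ + 4T² + 2` to its conjugate (`ρ̄ = −ρ`: the roots are purely imaginary): the rung's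
"CM involution is a polynomial". [folklore] -/
theorem exists_conjPolynomial_quarticSixteen :
    ∃ Q : Polynomial ℚ, ∀ ρ : ℂ, Polynomial.eval₂ (Int.castRingHom ℂ) ρ (X ^ 4 + 4 * X ^ 2 + 2 : Polynomial ℤ) = 0 →
      Polynomial.eval₂ (algebraMap ℚ ℂ) ρ Q = starRingEnd ℂ ρ := by
  refine ⟨-Polynomial.X, fun ρ hρ => ?_⟩
  have hne := conj_ne_self_of_quarticSixteen hρ
  rw [eval₂_quarticSixteen] at hρ
  rw [Polynomial.eval₂_neg, Polynomial.eval₂_X]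
  have hsq : (starRingEnd ℂ ρ) ^ 2 = ρ ^ 2 := by
    rw [← map_pow]; exact conj_sq_eq_sq_of_quarticSixteen hρ
  rcases sq_eq_sq_iff_eq_or_eq_neg.1 hsq with h | h
  · exact absurd h hne
  · exact h.symm

/-- `Φ₁₆ = T⁸ + 1` in `ℤ[T]`. [folklore] -/
theorem cyclotomic_sixteen_eq : Polynomial.cyclotomic 16 ℤ = X ^ 8 + 1 := by
  have h : Polynomial.cyclotomic (2 ^ (3 + 1)) ℤ = ∑ i ∈ Finset.range 2, (X ^ 2 ^ 3) ^ i :=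
    Polynomial.cyclotomic_prime_pow_eq_geom_sum Nat.prime_two
  have h16 : (2 : ℕ) ^ (3 + 1) = 16 := by norm_num
  rw [h16] at h
  rw [h, Finset.sum_range_succ, Finset.sum_range_succ, Finset.sum_range_zero, zero_add, pow_zero, pow_one]
  ring

/-- The division identity `P(T + T⁷) = Φ₁₆(T)·q(T)` in `ℤ[T]` for `P = T⁴ + 4T² + 2`. [folklore] -/
theorem quarticSixteen_comp_eq :
    ((X + X ^ 7) ^ 4 + 4 * (X + X ^ 7) ^ 2 + 2 : Polynomial ℤ) =
      (X ^ 8 + 1) * (X ^ 20 + 4 * X ^ 14 - X ^ 12 + 6 * X ^ 8 + X ^ 4 + 4 * X ^ 2 + 2) := by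
  ring

/-- `Φ₁₆(s) = 0 ⟹ P(s + s⁷) = 0` in any ring, `P = T⁴ + 4T² + 2`. [folklore] -/
theorem eval₂_quarticSixteen_add_pow_seven {R : Type*} [Ring R] (s : R)
    (hs : Polynomial.eval₂ (Int.castRingHom R) s (Polynomial.cyclotomic 16 ℤ) = 0) :
    Polynomial.eval₂ (Int.castRingHom R) (s + s ^ 7) (X ^ 4 + 4 * X ^ 2 + 2 : Polynomial ℤ) = 0 := by
  rw [cyclotomic_sixteen_eq, ← algebraMap_int_eq, ← Polynomial.aeval_def] at hs
  rw [← algebraMap_int_eq, ← Polynomial.aeval_def]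
  have h1 : Polynomial.aeval (s + s ^ 7) (X ^ 4 + 4 * X ^ 2 + 2 : Polynomial ℤ) =
      Polynomial.aeval s (((X + X ^ 7) ^ 4 + 4 * (X + X ^ 7) ^ 2 + 2 : Polynomial ℤ)) := by
    simp only [map_add, map_mul, map_pow, Polynomial.aeval_X, map_ofNat]
  rw [h1, quarticSixteen_comp_eq, map_mul, hs, zero_mul]

/-- In `End B`, `s ≫ s ≫ s ≫ s ≫ s ≫ s ≫ s` is the seventh power of `s`. -/
theorem end_of_comp_seven {B : Motives.AbelianVariety ℂ} (s : B ⟶ B) :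
    CategoryTheory.End.of (s ≫ s ≫ s ≫ s ≫ s ≫ s ≫ s) = CategoryTheory.End.of s ^ 7 := by
  simp only [pow_succ, pow_zero, one_mul, CategoryTheory.End.mul_def]

end Quartic

/-! ### §2 R3 for `K′ = ℚ(ζ₁₆)^{⟨7⟩} = ℚ(s + s⁷)` on the `ζ₁₆`-primitive loci over the Fermat pair `Xʰ₁₆ ⊗ Xʰ₁₆` -/

section SixteenCyclicQuartic

/-- **R3 for the cyclic quartic `K′ = ℚ(ζ₁₆ + ζ₁₆⁷)` on the Fermat-pair-dominated `ζ₁₆`-locus, from the two named facts.** For an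
abelian variety `B` with `s : B ⟶ B`, `Φ₁₆(s) = 0`, `dim B = 4h`, and a datum (`X₁, X₂` smooth projective Fermat varieties `Xʰ₁₆`,
`T` smooth projective of dimension `dim B`, `a : T ⟶ B` surjective, `b : ι → (T ⟶ X₁ ⊗ X₂)`), every class of
`weilClassesField B (s + s⁷) (T⁴ + 4T² + 2) (2h) = W_{K′} ⊗ ℂ` whose pull-back lies in `⨆ᵢ (bᵢ)^*(span of the rational (h,h)-classes
of X₁ ⊗ X₂)` and which is rational of type `(h,h)` is algebraic. At `h = 2`: the family `y¹⁶ = (x−b₁)(x−b₂)²(x−b₃)⁴(x−b₄)⁹` (report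
§3.3). [cite: Shioda1979PJA, §2 Thm. 2 (p. 112) with the list after Thm. 1] [cite: Fulton1998, §19.2 Cor. 19.2 (b)]
[cite: MoonenZarhin1998WeilClasses, §1] -/
theorem weilClassesCMField_cyclicPrymSixteen_cyclicQuartic_of_facts
    (hF₂ : hodgeClasses_algebraic_fermatProduct₂) (hP : fulton1998_map_mem_algebraicClasses) :
    ∀ (B : Motives.AbelianVariety ℂ) (s : B ⟶ B) (h : ℕ),
      Polynomial.eval₂ (Int.castRingHom (CategoryTheory.End B)) (s : CategoryTheory.End B)
        (Polynomial.cyclotomic 16 ℤ) = 0 → B.dim = 4 * h →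
    ∀ (X₁ X₂ T : Motives.SchemeOver ℂ),
      IsFermatVariety h 16 X₁ → IsSmoothProjective h X₁ → IsFermatVariety h 16 X₂ → IsSmoothProjective h X₂ →
      IsSmoothProjective B.dim T →
    ∀ (a : T ⟶ B.X), AlgebraicGeometry.Surjective a.left → ∀ (ι : Type) (b : ι → (T ⟶ X₁ ⊗ X₂)),
      ∀ c ∈ weilClassesField B (s + s ≫ s ≫ s ≫ s ≫ s ≫ s ≫ s) (X ^ 4 + 4 * X ^ 2 + 2 : Polynomial ℤ) (2 * h),
        complexBetti.map a (2 * h) c ∈ (⨆ i, (Submodule.span ℂ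
            {x : complexBetti (X₁ ⊗ X₂) (2 * h) |
              IsRationalClass x ∧ IsOfHodgeType (h + h) (X₁ ⊗ X₂) (2 * h) h h x}).map
              (complexBetti.map (b i) (2 * h)).hom) →
        IsRationalClass c → IsOfHodgeType B.dim B.X (2 * h) h h c → c ∈ algebraicClasses B.X h := by
  intro B s h _ _ X₁ X₂ T hF₁' hX₁ hF₂' hX₂ hT a ha ι b c _ hc _ _
  exact abelianVariety_mem_algebraicClasses_of_targetTransferFamily hP B (hX₁.tensor_holds hX₂)
    (span_rational_hodge_le_algebraicClasses_fermatProduct₂ hF₂ (Or.inr ⟨by norm_num, by norm_num⟩) hF₁' hX₁ hF₂' hX₂ h)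
    hT a b hc

/-- **The same body from the rung R3 itself** — an HONEST SPECIALISATION at `(A, φ, P, e, m) := (B, s + s⁷, T⁴ + 4T² + 2, 4, h)`:
`P` monic irreducible of degree `4 > 2` (Eisenstein), `P(s + s⁷) = 0` from `Φ₁₆(s) = 0`, `4·(2h) = 2·dim B`, roots non-real,
`Q = −T` — every arithmetic hypothesis DISCHARGED; the datum is not used. -/
theorem weilClassesCMField_cyclicPrymSixteen_cyclicQuartic_of_weilClassesCMField (hR : WeilClassesCMField) :
    ∀ (B : Motives.AbelianVariety ℂ) (s : B ⟶ B) (h : ℕ),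
      Polynomial.eval₂ (Int.castRingHom (CategoryTheory.End B)) (s : CategoryTheory.End B)
        (Polynomial.cyclotomic 16 ℤ) = 0 → B.dim = 4 * h →
    ∀ (X₁ X₂ T : Motives.SchemeOver ℂ),
      IsFermatVariety h 16 X₁ → IsSmoothProjective h X₁ → IsFermatVariety h 16 X₂ → IsSmoothProjective h X₂ →
      IsSmoothProjective B.dim T →
    ∀ (a : T ⟶ B.X), AlgebraicGeometry.Surjective a.left → ∀ (ι : Type) (b : ι → (T ⟶ X₁ ⊗ X₂)),
      ∀ c ∈ weilClassesField B (s + s ≫ s ≫ s ≫ s ≫ s ≫ s ≫ s) (X ^ 4 + 4 * X ^ 2 + 2 : Polynomial ℤ) (2 * h),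
        complexBetti.map a (2 * h) c ∈ (⨆ i, (Submodule.span ℂ
            {x : complexBetti (X₁ ⊗ X₂) (2 * h) |
              IsRationalClass x ∧ IsOfHodgeType (h + h) (X₁ ⊗ X₂) (2 * h) h h x}).map
              (complexBetti.map (b i) (2 * h)).hom) →
        IsRationalClass c → IsOfHodgeType B.dim B.X (2 * h) h h c → c ∈ algebraicClasses B.X h := by
  intro B s h hs hdim _ _ _ _ _ _ _ _ _ _ _ _ c hcW _ hc hmm
  have hφ : Polynomial.eval₂ (Int.castRingHom (CategoryTheory.End B))
      ((s + s ≫ s ≫ s ≫ s ≫ s ≫ s ≫ s : B ⟶ B) : CategoryTheory.End B) (X ^ 4 + 4 * X ^ 2 + 2 : Polynomial ℤ) = 0 := by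
    have h7 := eval₂_quarticSixteen_add_pow_seven (CategoryTheory.End.of s) hs
    rwa [← end_of_comp_seven] at h7
  exact hR B (s + s ≫ s ≫ s ≫ s ≫ s ≫ s ≫ s) (X ^ 4 + 4 * X ^ 2 + 2 : Polynomial ℤ) 4 h quarticSixteen_monic
    quarticSixteen_natDegree (by norm_num) quarticSixteen_irreducible hφ (by omega)
    (fun ρ hρ => conj_ne_self_of_quarticSixteen hρ) exists_conjPolynomial_quarticSixteen c hcW hc hmm

/-- **On-path lemma**: `HodgeConjecture → WeilClassesCMField →` R3 for `ℚ(ζ₁₆)^{⟨7⟩}` on the `ζ₁₆`-locus. -/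
theorem weilClassesCMField_cyclicPrymSixteen_cyclicQuartic_of_hodgeConjecture (hH : _root_.HodgeConjecture) :
    ∀ (B : Motives.AbelianVariety ℂ) (s : B ⟶ B) (h : ℕ),
      Polynomial.eval₂ (Int.castRingHom (CategoryTheory.End B)) (s : CategoryTheory.End B)
        (Polynomial.cyclotomic 16 ℤ) = 0 → B.dim = 4 * h →
    ∀ (X₁ X₂ T : Motives.SchemeOver ℂ),
      IsFermatVariety h 16 X₁ → IsSmoothProjective h X₁ → IsFermatVariety h 16 X₂ → IsSmoothProjective h X₂ →
      IsSmoothProjective B.dim T →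
    ∀ (a : T ⟶ B.X), AlgebraicGeometry.Surjective a.left → ∀ (ι : Type) (b : ι → (T ⟶ X₁ ⊗ X₂)),
      ∀ c ∈ weilClassesField B (s + s ≫ s ≫ s ≫ s ≫ s ≫ s ≫ s) (X ^ 4 + 4 * X ^ 2 + 2 : Polynomial ℤ) (2 * h),
        complexBetti.map a (2 * h) c ∈ (⨆ i, (Submodule.span ℂ
            {x : complexBetti (X₁ ⊗ X₂) (2 * h) |
              IsRationalClass x ∧ IsOfHodgeType (h + h) (X₁ ⊗ X₂) (2 * h) h h x}).map
              (complexBetti.map (b i) (2 * h)).hom) →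
        IsRationalClass c → IsOfHodgeType B.dim B.X (2 * h) h h c → c ∈ algebraicClasses B.X h :=
  weilClassesCMField_cyclicPrymSixteen_cyclicQuartic_of_weilClassesCMField (weilClassesCMField_of_hodgeConjecture hH)

end SixteenCyclicQuartic

end Summit.HodgeConjecture.HodgeConjecture.WeilTypeLadder

end
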